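import Mathlib
import Summits.PneNP.PneNP.Theses.OneSlice
import Summits.PneNP.PneNP.Theorems.OneSliceSliceTargetSplit
import Summits.PneNP.PneNP.Theorems.OneSliceMonotoneContinuationDefs

/-!
# Route OneSlice, crux `MonotoneContinuation` (stmt-PneNP-18471), line `Sketch_ideator1_r1` (ProfileLine) — the WIDTH-1 OBSTRUCTION

`profileJump_of_fragile`: a purely combinatorial lower bound on the profile jump at `j+1` of ANY monotone function
that is `η`-faithful on slice `j` to a slice set `h`, in terms of two features of `h` one level up: the fragile part
`Z` (points with at least one accepted down-neighbour) and the robust part `R = R_b` (points with at most `b` rejected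
down-neighbours), and the maximal fragile up-degree `φ` of a point of slice `j`.

Proof (pure counting). Let `E₀ = {x ∈ slice j : h x = 1, f x = 0}`; faithfulness gives `#E₀ ≤ η·#slice_j`.
* A point `z ∈ Z` rejected by `f` has, by monotonicity, all its down-neighbours rejected, in particular its accepted
  `h`-neighbour lies in `E₀`; charging `z` to it, every `x ∈ E₀` is charged at most `φ` times, so
  `#{z ∈ Z : f z = 0} ≤ φ·#E₀` (`profileJump_cardZ`).
* A point `z ∈ R` rejected by `f` has `≥ j+1-b` down-neighbours in `E₀`; double counting the comparable pairs
  between `E₀` and slice `j+1` (each `x ∈ slice j` has exactly `N - j` up-neighbours, `N = C(n,2)`) gives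
  `#{z ∈ R : f z = 0}·(j+1-b) ≤ (N-j)·#E₀` (`profileJump_cardR`), and `(N-j)·C(N,j) = (j+1)·C(N,j+1)` with
  `2b ≤ j+1` turns this into `≤ 2η·#slice_{j+1}`.
* `#{f = 1 on slice j} ≤ #h + η·#slice_j` bounds the rescaled level-`j` term.
The three estimates are combined by linear arithmetic (`profileJump_arith`).
-/

set_option linter.dupNamespace false -- `Summit.PneNP.PneNP.…`: summit = sub-problem (D-0017)

namespace Summit.PneNP.PneNP.Theorems.MonotoneContinuation

open Literature.Computability.Complexity hiding supp mem_supp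
open Finset hiding slice
open Classical
open Summit.PneNP.PneNP.Theorems (card_slice)
open Summit.PneNP.PneNP.Theorems.ConstantBand.Negative (Edge slice)
open Summit.PneNP.PneNP.Theorems.SliceACZero.Negative (supp mem_supp card_supp)
open Summit.PneNP.PneNP.Theorems.SliceTargetSplit (nbhd mem_nbhd transport ind nbhdCard sum_slice_sum_nbhd_left
  supp_subset_of_comp_of_le comp_comm le_of_supp_subset)

noncomputable section

variable {n : ℕ}

/-! ### Monotonicity along comparable pairs -/

/-- A monotone Boolean function rejecting `y` rejects everything below `y`. [folklore] -/
private theorem profileJump_false_of_le {f : (Edge n → Bool) → Bool} (hf : Monotone f) {x y : Edge n → Bool}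
    (hxy : x ≤ y) (hy : f y = false) : f x = false := by
  have h1 : f x ≤ f y := hf hxy
  rw [hy] at h1
  revert h1
  cases f x <;> decide

/-- A slice-`j` vector comparable with a weight-`(j+1)` vector lies below it. [folklore] -/
private theorem profileJump_down {j : ℕ} {x z : Edge n → Bool} (hz : edgeCount z = j + 1) (hx : x ∈ nbhd j z) :
    edgeCount x = j ∧ supp x ⊆ supp z := by
  rw [mem_nbhd] at hx
  exact ⟨hx.1, supp_subset_of_comp_of_le hx.2 (by rw [hx.1, hz]; exact Nat.le_succ j)⟩

/-! ### The two charging arguments -/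

/-- **Fragile points.** The points of `Z` rejected by a monotone `f` number at most `φ` times the rejected
accepted-by-`h` points of slice `j`: each such `z` lies above an `h`-point, which `f` rejects too, and every
slice-`j` point lies below at most `φ` points of `Z`. [folklore] -/
theorem profileJump_cardZ {j φ : ℕ} {h f : (Edge n → Bool) → Bool} (hf : Monotone f)
    {Z : Finset (Edge n → Bool)}
    (hZ : ∀ z ∈ Z, edgeCount z = j + 1 ∧ 1 ≤ #((nbhd j z).filter fun x => h x = true))
    (hφ : ∀ x ∈ slice n j, #(Z.filter fun z => ∀ e, x e = true → z e = true) ≤ φ) :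
    #(Z.filter fun z => f z = false) ≤ φ * #((slice n j).filter fun x => h x = true ∧ f x = false) := by
  set E₀ := (slice n j).filter fun x => h x = true ∧ f x = false with hE₀
  have hsub : (Z.filter fun z => f z = false) ⊆
      E₀.biUnion fun x => Z.filter fun z => ∀ e, x e = true → z e = true := by
    intro z hz
    rw [mem_filter] at hz
    obtain ⟨hzj, h1⟩ := hZ z hz.1
    obtain ⟨x, hx⟩ := card_pos.1 h1
    rw [mem_filter] at hx
    obtain ⟨hxj, hxz⟩ := profileJump_down hzj hx.1
    rw [mem_biUnion]
    refine ⟨x, ?_, ?_⟩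
    · rw [hE₀, mem_filter]
      refine ⟨?_, hx.2, profileJump_false_of_le hf (le_of_supp_subset hxz) hz.2⟩
      simp only [slice, mem_filter, mem_univ, true_and]
      exact hxj
    · rw [mem_filter]
      exact ⟨hz.1, fun e he => mem_supp.1 (hxz (mem_supp.2 he))⟩
  calc #(Z.filter fun z => f z = false)
      ≤ #(E₀.biUnion fun x => Z.filter fun z => ∀ e, x e = true → z e = true) := card_le_card hsub
    _ ≤ ∑ x ∈ E₀, #(Z.filter fun z => ∀ e, x e = true → z e = true) := card_biUnion_le
    _ ≤ ∑ _x ∈ E₀, φ := sum_le_sum fun x hx => hφ x (mem_filter.1 hx).1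
    _ = φ * #E₀ := by rw [sum_const, smul_eq_mul, mul_comm]

/-- **Robust points.** Double counting the pairs (rejected `h`-point of slice `j`, comparable point of slice
`j+1`): every point of `R` rejected by a monotone `f` contributes at least `j+1-b` pairs, and every slice-`j`
point lies in exactly `C(n,2) - j` pairs. [folklore] -/
theorem profileJump_cardR {j b : ℕ} {h f : (Edge n → Bool) → Bool} (hf : Monotone f)
    {R : Finset (Edge n → Bool)}
    (hR : ∀ z ∈ R, edgeCount z = j + 1 ∧ j + 1 - b ≤ #((nbhd j z).filter fun x => h x = true))
    (hb : b ≤ j + 1) :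
    (#(R.filter fun z => f z = false) : ℝ) * (j + 1 - b)
      ≤ (n.choose 2 - j : ℕ) * #((slice n j).filter fun x => h x = true ∧ f x = false) := by
  have hN : nbhdCard (n.choose 2) j (j + 1) = n.choose 2 - j := by
    unfold nbhdCard
    rw [if_neg (by omega), Nat.add_sub_cancel_left, Nat.choose_one_right]
  have hRs : (R.filter fun z => f z = false) ⊆ slice n (j + 1) := by
    intro z hz
    simp only [slice, mem_filter, mem_univ, true_and]
    exact (hR z (mem_filter.1 hz).1).1
  calc (#(R.filter fun z => f z = false) : ℝ) * (j + 1 - b)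
      = ∑ _z ∈ R.filter (fun z => f z = false), ((j + 1 - b : ℕ) : ℝ) := by
        rw [sum_const, nsmul_eq_mul, Nat.cast_sub hb]
        push_cast
        ring
    _ ≤ ∑ z ∈ R.filter (fun z => f z = false),
          (#((nbhd j z).filter fun x => h x = true ∧ f x = false) : ℝ) := by
        refine sum_le_sum fun z hz => ?_
        rw [mem_filter] at hz
        obtain ⟨hzj, hcard⟩ := hR z hz.1
        have heq : ((nbhd j z).filter fun x => h x = true) =
            (nbhd j z).filter fun x => h x = true ∧ f x = false := by
          refine filter_congr fun x hx => ?_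
          have hfx := profileJump_false_of_le hf (le_of_supp_subset (profileJump_down hzj hx).2) hz.2
          simp only [hfx, and_true]
        rw [← heq]
        exact_mod_cast hcard
    _ ≤ ∑ z ∈ slice n (j + 1), (#((nbhd j z).filter fun x => h x = true ∧ f x = false) : ℝ) :=
        sum_le_sum_of_subset_of_nonneg hRs fun _ _ _ => Nat.cast_nonneg _
    _ = ∑ z ∈ slice n (j + 1), ∑ x ∈ nbhd j z, (if h x = true ∧ f x = false then (1 : ℝ) else 0) := by
        simp only [sum_boole]
    _ = (nbhdCard (n.choose 2) j (j + 1) : ℝ) *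
          ∑ x ∈ slice n j, (if h x = true ∧ f x = false then (1 : ℝ) else 0) :=
        sum_slice_sum_nbhd_left _ _ _
    _ = ((n.choose 2 - j : ℕ) : ℝ) * #((slice n j).filter fun x => h x = true ∧ f x = false) := by
        rw [sum_boole, hN]

/-! ### Bookkeeping -/

/-- `(C(n,2) - j)·#slice_j = (j+1)·#slice_{j+1}` (both count the comparable pairs between the two slices).
[folklore] -/
private theorem profileJump_choose (n j : ℕ) :
    ((n.choose 2 - j : ℕ) : ℝ) * #(slice n j) = (j + 1) * #(slice n (j + 1)) := by
  rw [card_slice, card_slice]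
  have h' : (((n.choose 2).choose (j + 1) * (j + 1) : ℕ) : ℝ) = ((n.choose 2).choose j * (n.choose 2 - j) : ℕ) := by
    rw [Nat.choose_succ_right_eq]
  push_cast at h'
  linarith [h']

/-- If slice `j` is empty then so is slice `j+1`. [folklore] -/
private theorem profileJump_slice_succ_eq_zero {n j : ℕ} (h0 : (#(slice n j) : ℝ) = 0) :
    (#(slice n (j + 1)) : ℝ) = 0 := by
  rw [card_slice, Nat.cast_eq_zero, Nat.choose_eq_zero_iff] at h0
  rw [card_slice, Nat.cast_eq_zero, Nat.choose_eq_zero_iff]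
  exact Nat.lt_succ_of_lt h0

/-- The final bookkeeping of `profileJump_of_fragile` (linear arithmetic over the reals). [folklore] -/
private theorem profileJump_arith {Sj S1 ZR Hc Fj F1 Dc E Z0 R0 M φ η jb j1 : ℝ}
    (hD : Dc ≤ η * Sj) (hE : E ≤ Dc) (hFj : Fj ≤ Hc + Dc) (hZR : ZR ≤ F1 + Z0 + R0)
    (hZ0 : Z0 ≤ φ * E) (hR0 : R0 * jb ≤ M * E) (hM : M * Sj = j1 * S1) (hjb : j1 ≤ 2 * jb) (hj1 : 0 < j1)
    (hφ : 0 ≤ φ) (hM0 : 0 ≤ M) (hR00 : 0 ≤ R0) (hSj : 0 ≤ Sj) (hS1 : 0 ≤ S1) (hS : Sj = 0 → S1 = 0) :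
    ZR - S1 / Sj * Hc - η * (3 * S1 + φ * Sj) ≤ F1 - S1 / Sj * Fj := by
  have hρ : 0 ≤ S1 / Sj := div_nonneg hS1 hSj
  have hρD : S1 / Sj * Dc ≤ η * S1 := by
    rcases eq_or_ne Sj 0 with h0 | h0
    · rw [h0, div_zero, zero_mul, hS h0, mul_zero]
    · calc S1 / Sj * Dc ≤ S1 / Sj * (η * Sj) := mul_le_mul_of_nonneg_left hD hρ
        _ = η * S1 := by field_simp
  have hρF : S1 / Sj * Fj ≤ S1 / Sj * Hc + η * S1 := by
    calc S1 / Sj * Fj ≤ S1 / Sj * (Hc + Dc) := mul_le_mul_of_nonneg_left hFj hρ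
      _ = S1 / Sj * Hc + S1 / Sj * Dc := mul_add _ _ _
      _ ≤ _ := by linarith [hρD]
  have hZ0' : Z0 ≤ φ * (η * Sj) := hZ0.trans (mul_le_mul_of_nonneg_left (hE.trans hD) hφ)
  have hR0' : R0 ≤ 2 * η * S1 := by
    have hME : M * E ≤ M * (η * Sj) := mul_le_mul_of_nonneg_left (hE.trans hD) hM0
    have h1 : j1 * R0 ≤ j1 * (2 * η * S1) := by
      calc j1 * R0 ≤ 2 * jb * R0 := mul_le_mul_of_nonneg_right hjb hR00
        _ = 2 * (R0 * jb) := by ring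
        _ ≤ 2 * (M * (η * Sj)) := by linarith [hR0, hME]
        _ = 2 * η * (M * Sj) := by ring
        _ = j1 * (2 * η * S1) := by rw [hM]; ring
    exact le_of_mul_le_mul_left h1 hj1
  linarith [hρF, hZ0', hR0', hZR]

/-! ### The obstruction lemma -/

/-- **Profile jump forced by fragility (width-1 obstruction).** Let `h` be any Boolean function (read on slice `j`), `Z` a set of
level-`(j+1)` points each having at least one down-neighbour in `h`, `b ≤ (j+1)/2`, and suppose every point of slice `j` has at most
`φ` up-neighbours in `Z`. Then every MONOTONE `f` with at most `η·#slice_j` disagreements with `h` on slice `j` satisfies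
`#slice_{j+1} · (profile f (j+1) − profile f j) ≥ #(Z ∪ R_b) − (#slice_{j+1}/#slice_j)·#(h ∩ slice j) − η·(3·#slice_{j+1} + φ·#slice_j)`,
where `R_b` = level-`(j+1)` points with at least `j+1−b` down-neighbours in `h`. (All divisions avoided.) [folklore] -/
theorem profileJump_of_fragile :
  ∀ (n j b φ : ℕ) (η : ℝ) (h f : (Edge n → Bool) → Bool), Monotone f →
    ∀ (Z R : Finset (Edge n → Bool)),
    (∀ z ∈ Z, edgeCount z = j + 1 ∧ 1 ≤ #((nbhd j z).filter fun x => h x = true)) →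
    (∀ z, z ∈ R ↔ edgeCount z = j + 1 ∧ j + 1 - b ≤ #((nbhd j z).filter fun x => h x = true)) →
    2 * b ≤ j + 1 →
    (∀ x ∈ slice n j, #(Z.filter fun z => ∀ e, x e = true → z e = true) ≤ φ) →
    (#((slice n j).filter fun x => f x ≠ h x) : ℝ) ≤ η * #(slice n j) →
    (#(Z ∪ R) : ℝ) - (#(slice n (j + 1)) : ℝ) / #(slice n j) * #((slice n j).filter fun x => h x = true)
        - η * (3 * #(slice n (j + 1)) + φ * #(slice n j))
      ≤ #((slice n (j + 1)).filter fun z => f z = true)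
        - (#(slice n (j + 1)) : ℝ) / #(slice n j) * #((slice n j).filter fun x => f x = true) := by
  intro n j b φ η h f hf Z R hZ hR hb hφ hη
  have hRimp : ∀ z ∈ R, edgeCount z = j + 1 ∧ j + 1 - b ≤ #((nbhd j z).filter fun x => h x = true) :=
    fun z hz => (hR z).1 hz
  -- `E₀ ⊆ D`
  have hED : #((slice n j).filter fun x => h x = true ∧ f x = false) ≤ #((slice n j).filter fun x => f x ≠ h x) := by
    refine card_le_card fun x hx => ?_
    rw [mem_filter] at hx ⊢
    refine ⟨hx.1, ?_⟩
    rw [hx.2.1, hx.2.2]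
    exact Bool.false_ne_true
  -- `F_j ⊆ H ∪ D`
  have hFj : #((slice n j).filter fun x => f x = true)
      ≤ #((slice n j).filter fun x => h x = true) + #((slice n j).filter fun x => f x ≠ h x) := by
    refine (card_le_card fun x hx => ?_).trans (card_union_le _ _)
    rw [mem_filter] at hx
    rw [mem_union, mem_filter, mem_filter]
    cases hhx : h x
    · right
      refine ⟨hx.1, ?_⟩
      rw [hx.2]
      decide
    · left
      exact ⟨hx.1, rfl⟩
  -- `Z ∪ R` splits into its accepted part (inside the accepted part of slice `j+1`) and the two rejected parts
  have hZR : #(Z ∪ R) ≤ #((slice n (j + 1)).filter fun z => f z = true)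
      + #(Z.filter fun z => f z = false) + #(R.filter fun z => f z = false) := by
    have hsl : Z ∪ R ⊆ slice n (j + 1) := by
      intro z hz
      rw [mem_union] at hz
      simp only [slice, mem_filter, mem_univ, true_and]
      exact hz.elim (fun h' => (hZ z h').1) (fun h' => (hRimp z h').1)
    have h1 : #((Z ∪ R).filter fun z => f z = true) ≤ #((slice n (j + 1)).filter fun z => f z = true) :=
      card_le_card (filter_subset_filter _ hsl)
    have h2 : #((Z ∪ R).filter fun z => ¬ f z = true)
        ≤ #(Z.filter fun z => f z = false) + #(R.filter fun z => f z = false) := by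
      rw [filter_union]
      refine (card_union_le _ _).trans (add_le_add (card_le_card ?_) (card_le_card ?_)) <;>
      · intro z
        simp only [mem_filter, Bool.not_eq_true]
        exact id
    have h3 := card_filter_add_card_filter_not (s := Z ∪ R) (fun z => f z = true)
    omega
  -- cast to the reals and assemble
  have hED' : (#((slice n j).filter fun x => h x = true ∧ f x = false) : ℝ)
      ≤ #((slice n j).filter fun x => f x ≠ h x) := by exact_mod_cast hED
  have hFj' : (#((slice n j).filter fun x => f x = true) : ℝ)
      ≤ #((slice n j).filter fun x => h x = true) + #((slice n j).filter fun x => f x ≠ h x) := by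
    exact_mod_cast hFj
  have hZR' : (#(Z ∪ R) : ℝ) ≤ #((slice n (j + 1)).filter fun z => f z = true)
      + #(Z.filter fun z => f z = false) + #(R.filter fun z => f z = false) := by exact_mod_cast hZR
  have hZ0 : (#(Z.filter fun z => f z = false) : ℝ)
      ≤ (φ : ℝ) * #((slice n j).filter fun x => h x = true ∧ f x = false) := by
    exact_mod_cast profileJump_cardZ hf hZ hφ
  have hb' : (2 : ℝ) * b ≤ j + 1 := by exact_mod_cast hb
  exact profileJump_arith hη hED' hFj' hZR' hZ0 (profileJump_cardR hf hRimp (by omega)) (profileJump_choose n j)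
    (by linarith) (by positivity) (Nat.cast_nonneg _) (Nat.cast_nonneg _) (Nat.cast_nonneg _) (Nat.cast_nonneg _)
    (Nat.cast_nonneg _) profileJump_slice_succ_eq_zero

end

end Summit.PneNP.PneNP.Theorems.MonotoneContinuation
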